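import Summits.CriticalPhenomena.PercolationContinuityZ3.Theorems.PercLowPointHalfSpaceQuantitativeBGNWallDefs
import Summits.CriticalPhenomena.PercolationContinuityZ3.Theorems.PercLowPointHalfSpaceQuantitativeBGNWallTransfer
import Summits.CriticalPhenomena.PercolationContinuityZ3.Theorems.PercLowPointHalfSpaceQuantitativeBGNWallBootstrapPrep
import Literature.Probability.LatticeModels.ProdBernoulliIndependence
import Mathlib.Analysis.SpecialFunctions.Pow.Real
import HarnessLib

/-!
# `QuantitativeBGN` (stmt-CriticalPhenomena-0913), line `longrange-wall-ghost-bootstrap` — the bootstrap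

Stub `stub_wallBootstrap` of the skeleton `Cruxes/QuantitativeBGN/Lines/longrange_wall_ghost_bootstrap.lean`
(objects in `Theorems/PercLowPointHalfSpaceQuantitativeBGNWallDefs.lean`, namespace `…Theorems.WallGhost`;
ingredients in `Theorems/PercLowPointHalfSpaceQuantitativeBGNWallBootstrapPrep.lean`): Hutchcroft's
bootstrap (Probab. Theory Relat. Fields 181 (2021), arXiv:2008.11197: Prop. 1.4, Lemma 4.1, proof of
Thm. 1.1) run on the wall of the augmented model `augWall p λ α` with `θ = (1-α)/4`. From the basic wall
two-ghost inequality `Σ_{x∈s} (q_x/(1-q_x)) P(S'_{x,n})² ≤ C/n` (hypothesis, = `stub_wallTwoGhost`) and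
`E|C_H(0)| < ∞` for `p < p_c` (hypothesis, = `stub_wallStable`) it outputs ONE constant `B` with
`P_{augWall p λ α}(F ≥ n) ≤ B n^{-θ}` for all `p < p_c(ℤ³)`, `n ≥ 1`.

* `WallBootstrap.bootstrap_step`: if `P(F ≥ m) ≤ A m^{-θ}` for all `m` (`A ≥ 1`) then
  `P(F ≥ n) ≤ K √A n^{-θ}`, `K = K(C, λ, α)`. Fix `n ≥ 1` and the `N = n²` test points
  `x_{ij} = (0, n+2+i, j)`, `i, j < n` (long wall bonds at `0`, `‖x_{ij}‖∞ ≤ 3n`). For each,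
  `P(F ≥ n)² ≤ P(S'_{x,n}) + P(0 ↔_H x)` (`wall_sq_real_footGe_le`: Harris, wall-translation invariance,
  union bound, a.s. finiteness). Summing, `Σ_x P(0 ↔_H x) ≤ Σ_{y ∈ Λ_{3n}^w} P(0 ↔_H y) ≤ E[F ∧ |Λ_{3n}^w|]
  ≤ A Σ_{m ≤ 49n²} m^{-θ} ≤ 49 A n^{2-2θ}/(1-θ)`, and by Cauchy–Schwarz against the two-ghost hypothesis
  with `(1-q_x)/q_x = 1/(e^{u}-1) ≤ 1/u`, `u = λ‖x‖^{-(2+α)} ≥ λ (3n)^{-(2+α)}`: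
  `Σ_x P(S'_{x,n}) ≤ √((C/n) · N · 27 n^{2+α}/λ)`. Dividing by `N = n²`:
  `P(F ≥ n)² ≤ (√(27C/λ) + 49 A/(1-θ)) n^{-(1-α)/2}`.
* `stub_wallBootstrap`: the closed-set trick on `A_p = inf{A ≥ 1 : P(F ≥ m) ≤ A m^{-θ} ∀ m}` (nonempty by
  Markov, `P(F ≥ m) ≤ E|C_H(0)|/m`): `A_p ≤ max(1, K √A_p)` forces `A_p ≤ max(1, K²) =: B`.

No new definitions (test points and the wall box are written out over `![…]`, `box`, `Finset.subtype`).
-/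

noncomputable section

namespace Summit.CriticalPhenomena.PercolationContinuityZ3.Theorems

open MeasureTheory Literature.Probability.Percolation Literature.Probability.LatticeModels
open Summit.CriticalPhenomena.PercolationContinuityZ3.Theorems.WallGhost
open scoped ENNReal

namespace WallBootstrap

/-! ### Test points on the wall and the weights of their bonds -/

/-- A site with second coordinate `≥ 2` is not a lattice neighbour of `0`. [folklore] -/
theorem not_adj_of_two_le {x : Site 3} (h : 2 ≤ x 1) : ¬ (zdGraph 3).Adj 0 x := by
  rw [zdGraph_adj_iff]
  rintro ⟨k, hk | hk⟩
  · have := congrFun hk 1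
    simp only [Pi.add_apply, Pi.zero_apply, Pi.single_apply, zero_add] at this
    split_ifs at this <;> omega
  · have := congrFun hk 1
    simp only [Pi.add_apply, Pi.zero_apply, Pi.single_apply] at this
    split_ifs at this <;> omega

/-- The test point `x_{ij} = (0, n+2+i, j)` indexes a long wall bond at `0` (a `WallIdx`). [folklore] -/
theorem testPt_pred (n : ℕ) (ij : ℕ × ℕ) :
    (![0, (n : ℤ) + 2 + ij.1, (ij.2 : ℤ)] : Site 3) 0 = 0 ∧
      (![0, (n : ℤ) + 2 + ij.1, (ij.2 : ℤ)] : Site 3) ≠ 0 ∧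
        ¬ (zdGraph 3).Adj 0 (![0, (n : ℤ) + 2 + ij.1, (ij.2 : ℤ)] : Site 3) := by
  refine ⟨rfl, fun h => ?_, not_adj_of_two_le ?_⟩
  · have := congrFun h 1
    simp only [Fin.isValue, Matrix.cons_val_one, Matrix.cons_val_zero, Pi.zero_apply] at this
    omega
  · simp only [Fin.isValue, Matrix.cons_val_one, Matrix.cons_val_zero]
    omega

/-- The test points are pairwise distinct. [folklore] -/
theorem testPt_injective (n : ℕ) :
    Function.Injective fun ij : ℕ × ℕ => (![0, (n : ℤ) + 2 + ij.1, (ij.2 : ℤ)] : Site 3) := by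
  rintro ⟨i, j⟩ ⟨i', j'⟩ h
  have h1 := congrFun h 1
  have h2 := congrFun h 2
  simp only [Fin.isValue, Matrix.cons_val_one, Matrix.cons_val_zero, Matrix.cons_val] at h1 h2
  simp only [Prod.mk.injEq]
  constructor <;> omega

/-- The test points have sup norm `≤ 3n` (`i, j < n`, `n ≥ 1`). [folklore] -/
theorem norm_testPt_le {n : ℕ} (hn : 1 ≤ n) {ij : ℕ × ℕ} (hij : ij ∈ Finset.range n ×ˢ Finset.range n) :
    ‖(![0, (n : ℤ) + 2 + ij.1, (ij.2 : ℤ)] : Site 3)‖ ≤ 3 * n := by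
  obtain ⟨hi, hj⟩ := Finset.mem_product.1 hij
  rw [Finset.mem_range] at hi hj
  have hi' : (ij.1 : ℝ) + 1 ≤ n := by exact_mod_cast hi
  have hj' : (ij.2 : ℝ) + 1 ≤ n := by exact_mod_cast hj
  have hn' : (1 : ℝ) ≤ n := by exact_mod_cast hn
  refine (pi_norm_le_iff_of_nonneg (by positivity)).2 fun k => ?_
  fin_cases k
  · simp
  · simp only [Fin.mk_one, Fin.isValue, Matrix.cons_val_one, Matrix.cons_val_zero, Int.norm_eq_abs]
    push_cast
    rw [abs_of_nonneg (by positivity)]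
    linarith
  · simp only [Fin.reduceFinMk, Matrix.cons_val, Int.norm_eq_abs]
    push_cast
    rw [abs_of_nonneg (by positivity)]
    linarith

/-- The test points lie in the wall box `Λ_{3n}^w = {0} × [-3n, 3n]²`. [folklore] -/
theorem testPt_mem_wallBox {n : ℕ} {ij : ℕ × ℕ} (hij : ij ∈ Finset.range n ×ˢ Finset.range n) :
    (![0, (n : ℤ) + 2 + ij.1, (ij.2 : ℤ)] : Site 3) ∈
      (box 2 (3 * n)).image fun z : Site 2 => (Matrix.vecCons (0 : ℤ) z : Site 3) := by
  obtain ⟨hi, hj⟩ := Finset.mem_product.1 hij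
  rw [Finset.mem_range] at hi hj
  refine Finset.mem_image.2 ⟨![(n : ℤ) + 2 + ij.1, (ij.2 : ℤ)], mem_box.2 fun k => ?_, rfl⟩
  fin_cases k
  · simp only [Fin.zero_eta, Fin.isValue, Matrix.cons_val_zero]
    push_cast
    omega
  · simp only [Fin.mk_one, Fin.isValue, Matrix.cons_val_one]
    push_cast
    omega

/-- The wall box lies on the wall. [folklore] -/
theorem wallBox_zero {R : ℕ} {y : Site 3}
    (hy : y ∈ (box 2 R).image fun z : Site 2 => (Matrix.vecCons (0 : ℤ) z : Site 3)) : y 0 = 0 := by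
  obtain ⟨z, -, rfl⟩ := Finset.mem_image.1 hy
  rfl

/-- The probability of a long wall bond `{0,x}`: `q_x = 1 - exp(-λ‖x‖^{-(2+α)})`. [folklore] -/
theorem wallBondProb_eq (p : unitInterval) {lam : ℝ} (hlam : 0 ≤ lam) (α : ℝ) {x : Site 3}
    (hx0 : x 0 = 0) (hx : x ≠ 0) (hadj : ¬ (zdGraph 3).Adj 0 x) :
    wallBondProb p lam α x = 1 - Real.exp (-(lam * ‖x‖ ^ (-(2 + α)))) := by
  unfold wallBondProb
  have he : s((0 : Site 3), x) ∉ (zdGraph 3).edgeSet := by rwa [SimpleGraph.mem_edgeSet]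
  have hw : s((0 : Site 3), x) ∈ wallPairs := mk_mem_wallPairs.2 ⟨rfl, hx0, hx.symm⟩
  rw [coe_augProb p hlam, augWeight_of_mem_wallPairs p lam α he hw, pairDist_mk, zero_sub, norm_neg]

/-- The weights `q_x/(1-q_x) = e^{u} - 1`, `u = λ‖x‖^{-(2+α)}`, are positive and
`(1-q_x)/q_x ≤ 1/u ≤ L^{2+α}/λ` for `‖x‖ ≤ L` (`e^u - 1 ≥ u`). [cite: Hutchcroft2021, proof of Prop. 1.4] -/
theorem weight_pos_and_inv_le (p : unitInterval) {lam α : ℝ} (hlam : 0 < lam) (hα : 0 ≤ 2 + α)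
    {x : Site 3} (hx0 : x 0 = 0) (hx : x ≠ 0) (hadj : ¬ (zdGraph 3).Adj 0 x) {L : ℝ} (hL : ‖x‖ ≤ L) :
    0 < wallBondProb p lam α x / (1 - wallBondProb p lam α x) ∧
      1 / (wallBondProb p lam α x / (1 - wallBondProb p lam α x)) ≤ L ^ (2 + α) / lam := by
  set u : ℝ := lam * ‖x‖ ^ (-(2 + α)) with hu
  have hnorm : 0 < ‖x‖ := norm_pos_iff.2 hx
  have hupos : 0 < u := mul_pos hlam (Real.rpow_pos_of_pos hnorm _)
  have hexp := Real.exp_pos u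
  have hg : wallBondProb p lam α x / (1 - wallBondProb p lam α x) = Real.exp u - 1 := by
    rw [wallBondProb_eq p hlam.le α hx0 hx hadj, ← hu, sub_sub_cancel, Real.exp_neg]
    field_simp
  rw [hg]
  have hge : u ≤ Real.exp u - 1 := by linarith [Real.add_one_le_exp u]
  refine ⟨lt_of_lt_of_le hupos hge, ?_⟩
  calc 1 / (Real.exp u - 1) ≤ 1 / u := one_div_le_one_div_of_le hupos hge
    _ = ‖x‖ ^ (2 + α) / lam := by
        rw [hu, Real.rpow_neg hnorm.le]
        field_simp
    _ ≤ L ^ (2 + α) / lam :=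
        div_le_div_of_nonneg_right (Real.rpow_le_rpow hnorm.le hL hα) hlam.le

/-! ### The bootstrap step -/

/-- **The bootstrap step** (Hutchcroft's Lemma 4.1 and the Cauchy–Schwarz step of the proof of
Prop. 1.4, run on the wall at radius `≍ n` with `θ = (1-α)/4`): if
`Σ_{x∈s} (q_x/(1-q_x)) P(S'_{x,m})² ≤ C⁺/m` for all finite `s` and `m ≥ 1`, `C_H(0)` is a.s. finite, and
`P(F ≥ m) ≤ A m^{-θ}` for all `m ≥ 1` (`A ≥ 1`), then `P(F ≥ n) ≤ K √A n^{-θ}` with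
`K = √(√(27 C⁺/λ) + 49/(1-θ))`, independent of `p` and `A`.
[cite: Hutchcroft2021, Lemma 4.1 and proof of Prop. 1.4] -/
theorem bootstrap_step {α lam Cp : ℝ} (hα0 : 0 < α) (hα1 : α < 1) (hlam : 0 < lam) (hCp : 0 < Cp)
    (p : unitInterval)
    (hK1 : ∀ n : ℕ, 1 ≤ n → ∀ s : Finset WallIdx,
      ∑ x ∈ s, wallBondProb p lam α x.1 / (1 - wallBondProb p lam α x.1) *
        (augWall p lam α).real (wallTwoArm x.1 n) ^ 2 ≤ Cp * (n : ℝ)⁻¹)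
    (hnull : augWall p lam α {ω | ¬ (clusterH ω 0).Finite} = 0)
    {A : ℝ} (hA : 1 ≤ A)
    (htail : ∀ m : ℕ, 1 ≤ m → (augWall p lam α).real (footGe 0 m) ≤ A * (m : ℝ) ^ (-((1 - α) / 4)))
    {n : ℕ} (hn : 1 ≤ n) :
    (augWall p lam α).real (footGe 0 n) ≤
      Real.sqrt (Real.sqrt (27 * Cp / lam) + 49 / (1 - (1 - α) / 4)) * Real.sqrt A *
        (n : ℝ) ^ (-((1 - α) / 4)) := by
  set θ : ℝ := (1 - α) / 4 with hθ
  have hθ0 : 0 ≤ θ := by rw [hθ]; linarith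
  have hθ1 : θ < 1 := by rw [hθ]; linarith
  have h1θ : 0 < 1 - θ := by linarith
  set μ := augWall p lam α with hμ
  set Q : ℝ := μ.real (footGe 0 n) with hQ
  have hQ0 : 0 ≤ Q := measureReal_nonneg
  have hnpos : (0 : ℝ) < n := by exact_mod_cast hn
  have hA0 : 0 ≤ A := by linarith
  -- the test points `t`, the test set `s ⊆ WallIdx`, the wall box `Λ`
  set f : ℕ × ℕ → Site 3 := fun ij => ![0, (n : ℤ) + 2 + ij.1, (ij.2 : ℤ)] with hf
  set t : Finset (Site 3) := (Finset.range n ×ˢ Finset.range n).image f with ht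
  have htpred : ∀ y ∈ t, y 0 = 0 ∧ y ≠ 0 ∧ ¬ (zdGraph 3).Adj 0 y := fun y hy => by
    obtain ⟨ij, -, rfl⟩ := Finset.mem_image.1 hy
    exact testPt_pred n ij
  set s : Finset WallIdx := t.subtype fun x : Site 3 => x 0 = 0 ∧ x ≠ 0 ∧ ¬ (zdGraph 3).Adj 0 x with hs
  set Λ : Finset (Site 3) := (box 2 (3 * n)).image fun z : Site 2 => (Matrix.vecCons (0 : ℤ) z : Site 3)
    with hΛ
  have hts : ∀ x ∈ s, x.1 ∈ t := fun x hx => Finset.mem_subtype.1 hx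
  have hsum : ∀ F : Site 3 → ℝ, ∑ x ∈ s, F x.1 = ∑ y ∈ t, F y := fun F =>
    Finset.sum_subtype_of_mem F htpred
  set N : ℝ := (s.card : ℝ) with hN
  have hNeq : N = (n : ℝ) ^ 2 := by
    rw [hN, hs, Finset.card_subtype, Finset.filter_true_of_mem htpred, ht,
      Finset.card_image_of_injective _ (testPt_injective n), Finset.card_product, Finset.card_range]
    push_cast; ring
  have hNpos : 0 < N := by rw [hNeq]; positivity
  set K₁ : ℝ := Real.sqrt (27 * Cp / lam) with hK₁
  set K₂ : ℝ := 49 / (1 - θ) with hK₂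
  have hK₁0 : 0 ≤ K₁ := Real.sqrt_nonneg _
  -- the three quantities
  set P : Site 3 → ℝ := fun y => μ.real (wallTwoArm y n) with hP
  set τ : Site 3 → ℝ := fun y => μ.real (openConnIn {z : Site 3 | 0 ≤ z 0} 0 y) with hτ
  set g : Site 3 → ℝ := fun y => wallBondProb p lam α y / (1 - wallBondProb p lam α y) with hg
  -- powers of `n`
  have epow : ∀ a b : ℝ, (n : ℝ) ^ a * (n : ℝ) ^ b = (n : ℝ) ^ (a + b) :=
    fun a b => (Real.rpow_add hnpos a b).symm
  have esq : (n : ℝ) ^ 2 = (n : ℝ) ^ (2 : ℝ) := (Real.rpow_natCast (n : ℝ) 2).symm.trans (by norm_num)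
  -- (1)+(2): `N Q² ≤ Σ P + Σ τ`
  have h12 : N * Q ^ 2 ≤ ∑ x ∈ s, P x.1 + ∑ x ∈ s, τ x.1 := by
    rw [← Finset.sum_add_distrib]
    calc N * Q ^ 2 = ∑ _x ∈ s, Q ^ 2 := by rw [Finset.sum_const, nsmul_eq_mul]
      _ ≤ _ := Finset.sum_le_sum fun x _ => wall_sq_real_footGe_le p lam α hnull x.1 x.2.1 n
  -- (3): `Σ τ ≤ K₂ A n^{2-2θ}`
  have h3 : ∑ x ∈ s, τ x.1 ≤ K₂ * A * (n : ℝ) ^ (2 - 2 * θ) := by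
    set M : ℕ := Λ.card with hM
    have hM49 : (M : ℝ) ≤ 49 * (n : ℝ) ^ 2 := by
      have h1 : M ≤ (2 * (3 * n) + 1) ^ 2 := Finset.card_image_le.trans (card_box 2 (3 * n)).le
      have h2 : (2 * (3 * n) + 1) ^ 2 ≤ (7 * n) ^ 2 := Nat.pow_le_pow_left (by omega) 2
      have h3 : (M : ℝ) ≤ ((7 * n) ^ 2 : ℕ) := by exact_mod_cast h1.trans h2
      refine h3.trans (le_of_eq ?_)
      push_cast; ring
    calc ∑ x ∈ s, τ x.1 = ∑ y ∈ t, τ y := hsum τ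
      _ ≤ ∑ y ∈ Λ, τ y := by
          refine Finset.sum_le_sum_of_subset_of_nonneg (fun y hy => ?_) fun _ _ _ => measureReal_nonneg
          obtain ⟨ij, hij, rfl⟩ := Finset.mem_image.1 hy
          exact testPt_mem_wallBox hij
      _ ≤ ∑ i ∈ Finset.range M, μ.real (footGe 0 (i + 1)) :=
          sum_real_openConnIn_le μ _ fun _ hy => wallBox_zero hy
      _ ≤ ∑ i ∈ Finset.range M, A * ((i : ℝ) + 1) ^ (-θ) :=
          Finset.sum_le_sum fun i _ => by
            have := htail (i + 1) (Nat.succ_le_succ (Nat.zero_le i))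
            push_cast at this
            exact this
      _ = A * ∑ i ∈ Finset.range M, ((i : ℝ) + 1) ^ (-θ) := by rw [Finset.mul_sum]
      _ ≤ A * ((M : ℝ) ^ (1 - θ) / (1 - θ)) :=
          mul_le_mul_of_nonneg_left (sum_rpow_neg_le hθ0 hθ1 M) hA0
      _ ≤ A * ((49 * (n : ℝ) ^ 2) ^ (1 - θ) / (1 - θ)) := by gcongr
      _ ≤ A * (49 * (n : ℝ) ^ (2 - 2 * θ) / (1 - θ)) := by
          gcongr A * (?_ / _)
          rw [Real.mul_rpow (by norm_num) (by positivity)]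
          apply mul_le_mul _ (le_of_eq _) (by positivity) (by norm_num)
          · calc (49 : ℝ) ^ (1 - θ) ≤ (49 : ℝ) ^ (1 : ℝ) :=
                  Real.rpow_le_rpow_of_exponent_le (by norm_num) (by linarith)
              _ = 49 := Real.rpow_one _
          · rw [esq, ← Real.rpow_mul hnpos.le]
            congr 1; ring
      _ = K₂ * A * (n : ℝ) ^ (2 - 2 * θ) := by rw [hK₂]; ring
  -- (4): `Σ P ≤ K₁ n^{(3+α)/2}` (Cauchy–Schwarz against the two-ghost hypothesis)
  have h4 : ∑ x ∈ s, P x.1 ≤ K₁ * (n : ℝ) ^ ((3 + α) / 2) := by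
    have hw : ∀ x ∈ s, 0 < g x.1 ∧ 1 / g x.1 ≤ (3 * (n : ℝ)) ^ (2 + α) / lam := fun x hx => by
      obtain ⟨ij, hij, hxe⟩ := Finset.mem_image.1 (hts x hx)
      exact weight_pos_and_inv_le p hlam (by linarith) x.2.1 x.2.2.1 x.2.2.2
        (hxe ▸ norm_testPt_le hn hij)
    have hCS := sum_le_sqrt_of_weights s (fun x => g x.1) (fun x => P x.1) (fun x hx => (hw x hx).1)
      (fun _ _ => measureReal_nonneg) (hK1 n hn s)
      (show ∑ x ∈ s, 1 / g x.1 ≤ N * ((3 * (n : ℝ)) ^ (2 + α) / lam) from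
        calc ∑ x ∈ s, 1 / g x.1 ≤ ∑ _x ∈ s, (3 * (n : ℝ)) ^ (2 + α) / lam :=
              Finset.sum_le_sum fun x hx => (hw x hx).2
          _ = N * ((3 * (n : ℝ)) ^ (2 + α) / lam) := by rw [Finset.sum_const, nsmul_eq_mul])
    refine hCS.trans ?_
    have h27 : (3 : ℝ) ^ (2 + α) ≤ 27 := by
      calc (3 : ℝ) ^ (2 + α) ≤ (3 : ℝ) ^ ((3 : ℕ) : ℝ) :=
            Real.rpow_le_rpow_of_exponent_le (by norm_num) (by push_cast; linarith)
        _ = 27 := by rw [Real.rpow_natCast]; norm_num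
    have hprod : Cp * (n : ℝ)⁻¹ * (N * ((3 * (n : ℝ)) ^ (2 + α) / lam)) ≤
        27 * Cp / lam * (n : ℝ) ^ (3 + α) := by
      have e1 : Cp * (n : ℝ)⁻¹ * (N * ((3 * (n : ℝ)) ^ (2 + α) / lam)) =
          (3 : ℝ) ^ (2 + α) * (Cp / lam) * (n : ℝ) ^ (3 + α) := by
        rw [Real.mul_rpow (by norm_num) hnpos.le, hNeq, esq, ← Real.rpow_neg_one, div_eq_mul_inv,
          div_eq_mul_inv]
        have : (n : ℝ) ^ (3 + α) = (n : ℝ) ^ (-1 : ℝ) * (n : ℝ) ^ (2 : ℝ) * (n : ℝ) ^ (2 + α) := by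
          rw [epow, epow]; congr 1; ring
        rw [this]; ring
      rw [e1]
      have : 0 ≤ Cp / lam * (n : ℝ) ^ (3 + α) := by positivity
      calc (3 : ℝ) ^ (2 + α) * (Cp / lam) * (n : ℝ) ^ (3 + α)
          = (3 : ℝ) ^ (2 + α) * (Cp / lam * (n : ℝ) ^ (3 + α)) := by ring
        _ ≤ 27 * (Cp / lam * (n : ℝ) ^ (3 + α)) := mul_le_mul_of_nonneg_right h27 this
        _ = 27 * Cp / lam * (n : ℝ) ^ (3 + α) := by ring
    calc Real.sqrt (Cp * (n : ℝ)⁻¹ * (N * ((3 * (n : ℝ)) ^ (2 + α) / lam)))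
        ≤ Real.sqrt (27 * Cp / lam * (n : ℝ) ^ (3 + α)) := Real.sqrt_le_sqrt hprod
      _ = K₁ * (n : ℝ) ^ ((3 + α) / 2) := by
          rw [Real.sqrt_mul (by positivity), hK₁, Real.sqrt_eq_rpow ((n : ℝ) ^ (3 + α)),
            ← Real.rpow_mul hnpos.le]
          congr 2; ring
  -- (5): combine and divide by `N = n²`
  have hsq : Q ^ 2 ≤ (K₁ + K₂) * A * (n : ℝ) ^ (-(2 * θ)) := by
    have e3 : (n : ℝ) ^ ((3 + α) / 2) / N = (n : ℝ) ^ (-(2 * θ)) := by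
      rw [hNeq, esq, ← Real.rpow_sub hnpos]; congr 1; rw [hθ]; ring
    have e4 : (n : ℝ) ^ (2 - 2 * θ) / N = (n : ℝ) ^ (-(2 * θ)) := by
      rw [hNeq, esq, ← Real.rpow_sub hnpos]; congr 1; ring
    have hpow0 : 0 ≤ (n : ℝ) ^ (-(2 * θ)) := Real.rpow_nonneg hnpos.le _
    calc Q ^ 2 ≤ (∑ x ∈ s, P x.1 + ∑ x ∈ s, τ x.1) / N := by
          rw [le_div_iff₀ hNpos, mul_comm]; exact h12
      _ ≤ (K₁ * (n : ℝ) ^ ((3 + α) / 2) + K₂ * A * (n : ℝ) ^ (2 - 2 * θ)) / N := by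
          gcongr ?_ / N
          exact add_le_add h4 h3
      _ = K₁ * (n : ℝ) ^ (-(2 * θ)) + K₂ * A * (n : ℝ) ^ (-(2 * θ)) := by
          rw [add_div, mul_div_assoc, mul_div_assoc, e3, e4]
      _ ≤ K₁ * A * (n : ℝ) ^ (-(2 * θ)) + K₂ * A * (n : ℝ) ^ (-(2 * θ)) := by
          have : K₁ * 1 ≤ K₁ * A := mul_le_mul_of_nonneg_left hA hK₁0
          nlinarith
      _ = (K₁ + K₂) * A * (n : ℝ) ^ (-(2 * θ)) := by ring
  -- (6): square roots
  have e5 : Real.sqrt ((n : ℝ) ^ (-(2 * θ))) = (n : ℝ) ^ (-θ) := by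
    rw [Real.sqrt_eq_rpow, ← Real.rpow_mul hnpos.le]; congr 1; ring
  calc μ.real (footGe 0 n) = Q := rfl
    _ = Real.sqrt (Q ^ 2) := (Real.sqrt_sq hQ0).symm
    _ ≤ Real.sqrt ((K₁ + K₂) * A * (n : ℝ) ^ (-(2 * θ))) := Real.sqrt_le_sqrt hsq
    _ = Real.sqrt (K₁ + K₂) * Real.sqrt A * (n : ℝ) ^ (-θ) := by
        rw [Real.sqrt_mul (by positivity), Real.sqrt_mul (by positivity), e5]

end WallBootstrap

open WallBootstrap in
/-- **stub_wallBootstrap.** Hutchcroft's bootstrap run on the wall (`d_wall = 2`, `0 < α < 1`,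
`θ = (1-α)/4`): Harris–FKG for the increasing events `{F₀ ≥ n}`, `{F_x ≥ n}` under the product
measure `augWall`, wall-translation invariance (`F_x =ᵈ F₀`), the union bound
`P(S'_{x,n}) ≥ P(F ≥ n)² - P(0 ↔_H x)` (a.s. finiteness from the subcriticality hypothesis), the bound
`Σ_{x ∈ Λ_{3n}^w} P(0 ↔_H x) ≤ E[F ∧ |Λ_{3n}^w|] ≤ 49 A n^{2-2θ}/(1-θ)`, Cauchy–Schwarz against the wall
two-ghost inequality over the `n²` test points `x = (0, n+2+i, j)` (`i, j < n`, `‖x‖ ≤ 3n`,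
`(1-q_x)/q_x ≤ ‖x‖^{2+α}/λ`), and the closed-set trick `A_p ≤ max(1, K A_p^{1/2}) ⇒ A_p ≤ max(1, K²)`
(`A_p < ∞` because `P(F ≥ m) ≤ E|C_H(0)|/m`, Markov). The output constant `B = max(1, K²)`,
`K = √(√(27 max(C,1)/λ) + 49/(1-θ))`, does not depend on `p`.
[cite: Hutchcroft2021, Prop. 1.4, Lemma 4.1 and proof of Thm. 1.1] -/
theorem stub_wallBootstrap : ∀ α lam : ℝ, 0 < α → α < 1 → 0 < lam → (∃ C : ℝ, ∀ p : unitInterval, ∀ n : ℕ, 1 ≤ n → ∀ s : Finset WallIdx, ∑ x ∈ s, wallBondProb p lam α x.1 / (1 - wallBondProb p lam α x.1) * (augWall p lam α).real (wallTwoArm x.1 n) ^ 2 ≤ C * (n : ℝ)⁻¹) → (∀ p : unitInterval, (p : ℝ) < criticalProb (zdGraph 3) (0 : Site 3) → ∫⁻ ω, ((clusterH ω 0).encard : ℝ≥0∞) ∂(augWall p lam α) < ⊤) → ∃ B : ℝ, ∀ p : unitInterval, (p : ℝ) < criticalProb (zdGraph 3) (0 : Site 3) → ∀ n : ℕ, 1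 ≤ n → (augWall p lam α).real (footGe 0 n) ≤ B * (n : ℝ) ^ (-((1 - α) / 4)) := by
  intro α lam hα0 hα1 hlam hK1 hK2
  obtain ⟨C, hC⟩ := hK1
  set Cp : ℝ := max C 1 with hCp
  have hCp0 : 0 < Cp := lt_max_of_lt_right one_pos
  set K : ℝ := Real.sqrt (Real.sqrt (27 * Cp / lam) + 49 / (1 - (1 - α) / 4)) with hK
  have hK0 : 0 ≤ K := Real.sqrt_nonneg _
  refine ⟨max 1 (K ^ 2), fun p hp n hn => ?_⟩
  set μ := augWall p lam α with hμ
  have hfin := hK2 p hp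
  have hnull := measure_not_finite_eq_zero p lam α hfin
  have hK1' : ∀ m : ℕ, 1 ≤ m → ∀ s : Finset WallIdx,
      ∑ x ∈ s, wallBondProb p lam α x.1 / (1 - wallBondProb p lam α x.1) *
        μ.real (wallTwoArm x.1 m) ^ 2 ≤ Cp * (m : ℝ)⁻¹ := fun m hm s =>
    (hC p m hm s).trans (mul_le_mul_of_nonneg_right (le_max_left _ _) (inv_nonneg.2 (Nat.cast_nonneg _)))
  set Pm : ℕ → ℝ := fun m => μ.real (footGe 0 m) with hPm
  -- the set of admissible constants: nonempty (Markov) and closed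
  set 𝒜 : Set ℝ := {A | 1 ≤ A ∧ ∀ m : ℕ, 1 ≤ m → Pm m ≤ A * (m : ℝ) ^ (-((1 - α) / 4))} with h𝒜
  set χ : ℝ := (∫⁻ ω, ((clusterH ω 0).encard : ℝ≥0∞) ∂μ).toReal with hχ
  have hχ0 : 0 ≤ χ := ENNReal.toReal_nonneg
  have h𝒜ne : 𝒜.Nonempty := by
    refine ⟨max 1 χ, le_max_left _ _, fun m hm => ?_⟩
    have hm1 : (1 : ℝ) ≤ m := by exact_mod_cast hm
    calc Pm m ≤ χ / m := real_footGe_le_div p lam α hfin hm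
      _ = χ * (m : ℝ) ^ (-(1 : ℝ)) := by rw [Real.rpow_neg_one, div_eq_mul_inv]
      _ ≤ χ * (m : ℝ) ^ (-((1 - α) / 4)) :=
          mul_le_mul_of_nonneg_left (Real.rpow_le_rpow_of_exponent_le hm1 (by linarith)) hχ0
      _ ≤ max 1 χ * (m : ℝ) ^ (-((1 - α) / 4)) :=
          mul_le_mul_of_nonneg_right (le_max_right _ _) (by positivity)
  have h𝒜bdd : BddBelow 𝒜 := ⟨1, fun A hA => hA.1⟩
  set Astar := sInf 𝒜 with hAstar
  have hAstar1 : 1 ≤ Astar := le_csInf h𝒜ne fun A hA => hA.1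
  have hAstar_mem : ∀ m : ℕ, 1 ≤ m → Pm m ≤ Astar * (m : ℝ) ^ (-((1 - α) / 4)) := by
    intro m hm
    have hmpos : (0 : ℝ) < m := by exact_mod_cast hm
    have hpow : 0 < (m : ℝ) ^ (-((1 - α) / 4)) := Real.rpow_pos_of_pos hmpos _
    rw [← div_le_iff₀ hpow]
    exact le_csInf h𝒜ne fun A hA => (div_le_iff₀ hpow).2 (hA.2 m hm)
  -- the bootstrap step at `A*`: `max 1 (K √A*)` is admissible, so `A* ≤ max 1 (K √A*)`
  have hstep : ∀ m : ℕ, 1 ≤ m → Pm m ≤ K * Real.sqrt Astar * (m : ℝ) ^ (-((1 - α) / 4)) :=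
    fun m hm => bootstrap_step hα0 hα1 hlam hCp0 p hK1' hnull hAstar1 hAstar_mem hm
  have hmem : max 1 (K * Real.sqrt Astar) ∈ 𝒜 :=
    ⟨le_max_left _ _, fun m hm => (hstep m hm).trans
      (mul_le_mul_of_nonneg_right (le_max_right _ _) (by positivity))⟩
  have hAle : Astar ≤ max 1 (K * Real.sqrt Astar) := csInf_le h𝒜bdd hmem
  have hAbound : Astar ≤ max 1 (K ^ 2) := by
    rcases le_max_iff.1 hAle with h | h
    · exact h.trans (le_max_left _ _)
    · have hsq : Real.sqrt Astar * Real.sqrt Astar = Astar := Real.mul_self_sqrt (by linarith)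
      have hspos : 0 < Real.sqrt Astar := Real.sqrt_pos.2 (by linarith)
      have h' : Real.sqrt Astar * Real.sqrt Astar ≤ K * Real.sqrt Astar := by rwa [hsq]
      have h'' : Real.sqrt Astar ≤ K := le_of_mul_le_mul_right h' hspos
      refine le_trans ?_ (le_max_right _ _)
      calc Astar = Real.sqrt Astar * Real.sqrt Astar := hsq.symm
        _ ≤ K * K := mul_le_mul h'' h'' hspos.le hK0
        _ = K ^ 2 := (sq K).symm
  -- conclude
  have hnpos : (0 : ℝ) < n := by exact_mod_cast hn
  calc μ.real (footGe 0 n) = Pm n := rfl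
    _ ≤ Astar * (n : ℝ) ^ (-((1 - α) / 4)) := hAstar_mem n hn
    _ ≤ max 1 (K ^ 2) * (n : ℝ) ^ (-((1 - α) / 4)) :=
        mul_le_mul_of_nonneg_right hAbound (Real.rpow_nonneg hnpos.le _)

end Summit.CriticalPhenomena.PercolationContinuityZ3.Theorems

end
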